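import Mathlib

/-!
# `ThresholdSubsetTriples` (crux stmt-MatrixMultiplication-10882), line `SketchIdeator6`:
# threshold asymptotics for the block-structured volume bound

Negative-side helper (line lead c6, 2026-08-17; `sorry`-free, standard axioms).  Pure real analysis,
no permutations: if a volume `V` satisfies the cleared bound `V · (2n)! ≤ (n+1)^3 (4nB)^{2n}` of
`Negative.volume_mul_factorial_le_of_blockStructured` (file `GenusBlockStructured.lean`) with block size
`(16B)^4 ≤ n^3`, then `V ≤ (n!)^{3/2} e^{-c√n}` for all `n ≥ n₀(c)`
(`le_threshold_of_volume_mul_factorial_le`).  Ingredients: Mathlib's Stirling lower bound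
`Stirling.le_factorial_stirling` in the form `(m/e)^m ≤ m!` (`pow_div_exp_le_factorial`),
`log (n+1) ≤ 3√n` (`log_succ_le_three_sqrt`), the decay estimate `(n+1)^6 e^{2c√n} ≤ 2^n` for
`√n ≥ 27 + 3c` (`pow_six_mul_exp_le_two_pow`) and `e^7 ≤ 2048` (`exp_one_pow_seven_le`); the comparison
is done on squares (`V² ≤ (n+1)^6 (e^4/4096)^n n^{3n}` against `n!^3 e^{-2c√n} ≥ n^{3n}e^{-3n}e^{-2c√n}`).
-/

set_option linter.dupNamespace false

namespace Summit.MatrixMultiplication.MatrixMultiplication.Theorems.ThresholdSubsetTriples.Negative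

section Asymptotics

/-- `(m/e)^m ≤ m!` — Stirling's lower bound (Mathlib `Stirling.le_factorial_stirling`) without the
`√(2πm)` factor, for `1 ≤ m`. -/
theorem pow_div_exp_le_factorial {m : ℕ} (hm : 1 ≤ m) :
    ((m : ℝ) / Real.exp 1) ^ m ≤ (m.factorial : ℝ) := by
  have h := Stirling.le_factorial_stirling m
  have hm1 : (1 : ℝ) ≤ m := by exact_mod_cast hm
  have h1 : 1 ≤ Real.sqrt (2 * Real.pi * m) := by
    rw [Real.le_sqrt (by norm_num) (by positivity)]
    nlinarith [Real.pi_gt_three]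
  have h0 : 0 ≤ ((m : ℝ) / Real.exp 1) ^ m := by positivity
  calc ((m : ℝ) / Real.exp 1) ^ m = 1 * ((m : ℝ) / Real.exp 1) ^ m := (one_mul _).symm
    _ ≤ Real.sqrt (2 * Real.pi * m) * ((m : ℝ) / Real.exp 1) ^ m :=
        mul_le_mul_of_nonneg_right h1 h0
    _ ≤ m.factorial := h

/-- `log (n+1) ≤ 3 √n` for `n ≥ 1`. -/
theorem log_succ_le_three_sqrt {n : ℕ} (hn : 1 ≤ n) :
    Real.log ((n : ℝ) + 1) ≤ 3 * Real.sqrt n := by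
  have hn1 : (1 : ℝ) ≤ n := by exact_mod_cast hn
  have hpos : (0 : ℝ) < Real.sqrt ((n : ℝ) + 1) := Real.sqrt_pos.2 (by positivity)
  have h1 : Real.log ((n : ℝ) + 1) = 2 * Real.log (Real.sqrt ((n : ℝ) + 1)) := by
    rw [Real.log_sqrt (by positivity)]; ring
  have h2 : Real.log (Real.sqrt ((n : ℝ) + 1)) ≤ Real.sqrt ((n : ℝ) + 1) - 1 :=
    Real.log_le_sub_one_of_pos hpos
  have h3 : Real.sqrt ((n : ℝ) + 1) ≤ Real.sqrt (2 * n) := Real.sqrt_le_sqrt (by linarith)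
  have h4 : Real.sqrt (2 * (n : ℝ)) = Real.sqrt 2 * Real.sqrt n := Real.sqrt_mul (by norm_num) _
  have h5 : Real.sqrt 2 ≤ 3 / 2 := by
    rw [Real.sqrt_le_left (by norm_num)]; norm_num
  have h6 : 0 ≤ Real.sqrt (n : ℝ) := Real.sqrt_nonneg _
  have h7 : Real.sqrt (2 * (n : ℝ)) ≤ 3 / 2 * Real.sqrt n := by
    rw [h4]; exact mul_le_mul_of_nonneg_right h5 h6
  linarith

/-- Key decay estimate: for `n ≥ 1` with `√n ≥ 27 + 3c`, `(n+1)^6 · e^{2c√n} ≤ 2^n`. -/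
theorem pow_six_mul_exp_le_two_pow {c : ℝ} (hc : 0 ≤ c) {n : ℕ} (hn : 1 ≤ n)
    (hcn : 27 + 3 * c ≤ Real.sqrt n) :
    ((n : ℝ) + 1) ^ 6 * Real.exp (2 * c * Real.sqrt n) ≤ (2 : ℝ) ^ n := by
  have hsq : Real.sqrt n * Real.sqrt n = n := Real.mul_self_sqrt (by positivity)
  have hlog := log_succ_le_three_sqrt hn
  have hl2 := Real.log_two_gt_d9
  have h6 : 0 ≤ Real.sqrt (n : ℝ) := Real.sqrt_nonneg _
  -- compare exponents
  have hexp : 6 * Real.log ((n : ℝ) + 1) + 2 * c * Real.sqrt n ≤ n * Real.log 2 := by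
    have h1 : 6 * Real.log ((n : ℝ) + 1) + 2 * c * Real.sqrt n ≤ (18 + 2 * c) * Real.sqrt n := by
      nlinarith
    have h2 : (18 + 2 * c) * Real.sqrt n ≤ 0.6931471803 * ((27 + 3 * c) * Real.sqrt n) := by
      nlinarith
    have h3 : (27 + 3 * c) * Real.sqrt n ≤ Real.sqrt n * Real.sqrt n :=
      mul_le_mul_of_nonneg_right hcn h6
    rw [hsq] at h3
    have h4 : 0.6931471803 * (n : ℝ) ≤ n * Real.log 2 := by
      have : (0 : ℝ) ≤ n := by positivity
      nlinarith
    nlinarith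
  have hpos : (0 : ℝ) < (n : ℝ) + 1 := by positivity
  have hA : ((n : ℝ) + 1) ^ 6 = Real.exp (6 * Real.log ((n : ℝ) + 1)) := by
    rw [show (6 : ℝ) * Real.log ((n : ℝ) + 1) = ((6 : ℕ) : ℝ) * Real.log ((n : ℝ) + 1) by norm_num,
      Real.exp_nat_mul, Real.exp_log hpos]
  have hB : Real.exp ((n : ℝ) * Real.log 2) = (2 : ℝ) ^ n := by
    rw [Real.exp_nat_mul, Real.exp_log (by norm_num)]
  calc ((n : ℝ) + 1) ^ 6 * Real.exp (2 * c * Real.sqrt n)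
      = Real.exp (6 * Real.log ((n : ℝ) + 1) + 2 * c * Real.sqrt n) := by rw [hA, ← Real.exp_add]
    _ ≤ Real.exp (n * Real.log 2) := Real.exp_le_exp.2 hexp
    _ = (2 : ℝ) ^ n := hB

/-- `e^7 ≤ 2048` (numerically `e^7 ≈ 1096.6`). -/
theorem exp_one_pow_seven_le : Real.exp 1 ^ 7 ≤ 2048 := by
  have h := Real.exp_one_lt_d9
  have h0 : 0 ≤ Real.exp 1 := (Real.exp_pos 1).le
  calc Real.exp 1 ^ 7 ≤ (2.7182818286 : ℝ) ^ 7 := pow_le_pow_left₀ h0 h.le 7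
    _ ≤ 2048 := by norm_num

/-- **Threshold asymptotics for the block-structured class.**  For every `c ≥ 0` there is `n₀` such that
for `n ≥ n₀`: if `(16B)^4 ≤ n^3` and `V · (2n)! ≤ (n+1)^3 (4nB)^{2n}`, then
`V ≤ (n!)^{3/2} e^{-c√n}`.  (Stirling: `(2n)! ≥ (2n/e)^{2n}`, `n! ≥ (n/e)^n`; then
`V² ≤ (n+1)^6 (e^4/4096)^n n^{3n}` against `n!^3 ≥ n^{3n} e^{-3n}`, and `e^7 ≤ 2048`.) -/
theorem le_threshold_of_volume_mul_factorial_le {c : ℝ} (hc : 0 ≤ c) :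
    ∃ n₀ : ℕ, ∀ n : ℕ, n₀ ≤ n → ∀ V B : ℕ, (16 * B) ^ 4 ≤ n ^ 3 →
      V * (2 * n).factorial ≤ (n + 1) ^ 3 * (4 * n * B) ^ (2 * n) →
      (V : ℝ) ≤ (n.factorial : ℝ) ^ ((3 : ℝ) / 2) * Real.exp (-(c * Real.sqrt n)) := by
  refine ⟨⌈(27 + 3 * c) ^ 2⌉₊ + 1, fun n hn V B hB hV => ?_⟩
  have hn1 : 1 ≤ n := le_trans (Nat.le_add_left 1 _) hn
  have hnpos : (0 : ℝ) < n := by exact_mod_cast hn1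
  have hcn : 27 + 3 * c ≤ Real.sqrt n := by
    rw [Real.le_sqrt (by positivity) (by positivity)]
    have h1 : ((27 + 3 * c) ^ 2 : ℝ) ≤ ⌈(27 + 3 * c) ^ 2⌉₊ := Nat.le_ceil _
    have h2 : (⌈(27 + 3 * c) ^ 2⌉₊ : ℝ) ≤ n := by exact_mod_cast le_trans (Nat.le_succ _) hn
    linarith
  -- casts of the hypotheses
  have hV' : (V : ℝ) * ((2 * n).factorial : ℝ) ≤ ((n : ℝ) + 1) ^ 3 * (4 * n * B) ^ (2 * n) := by
    exact_mod_cast hV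
  have hB' : ((16 : ℝ) * B) ^ 4 ≤ (n : ℝ) ^ 3 := by exact_mod_cast hB
  -- Stirling lower bounds, `e := exp 1`
  set e := Real.exp 1 with he_def
  have he : 0 < e := Real.exp_pos 1
  have hS2 : (((2 * n : ℕ) : ℝ) / e) ^ (2 * n) ≤ ((2 * n).factorial : ℝ) :=
    pow_div_exp_le_factorial (by omega)
  have hS1 : ((n : ℝ) / e) ^ n ≤ (n.factorial : ℝ) := pow_div_exp_le_factorial hn1
  -- (a)  V ≤ (n+1)^3 (2eB)^{2n}
  have hL : (0 : ℝ) < (((2 * n : ℕ) : ℝ) / e) ^ (2 * n) := by positivity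
  have hprod : (2 * e * (B : ℝ)) * (((2 * n : ℕ) : ℝ) / e) = 4 * n * B := by
    push_cast; field_simp; ring
  have hVa : (V : ℝ) ≤ ((n : ℝ) + 1) ^ 3 * (2 * e * B) ^ (2 * n) := by
    have h1 : (V : ℝ) * ((((2 * n : ℕ) : ℝ) / e) ^ (2 * n)) ≤
        ((n : ℝ) + 1) ^ 3 * (4 * n * B) ^ (2 * n) :=
      le_trans (mul_le_mul_of_nonneg_left hS2 (by positivity)) hV'
    have h2 : ((n : ℝ) + 1) ^ 3 * (4 * n * B) ^ (2 * n) =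
        (((n : ℝ) + 1) ^ 3 * (2 * e * B) ^ (2 * n)) * ((((2 * n : ℕ) : ℝ) / e) ^ (2 * n)) := by
      rw [← hprod, mul_pow]; ring
    rw [h2] at h1
    exact le_of_mul_le_mul_right h1 hL
  -- (b)  V² ≤ (n+1)^6 (16 e^4 B^4)^n,  16 e^4 B^4 ≤ (e^4/4096) n^3
  have hV0 : (0 : ℝ) ≤ V := by positivity
  have hVb : (V : ℝ) ^ 2 ≤ ((n : ℝ) + 1) ^ 6 * (16 * e ^ 4 * (B : ℝ) ^ 4) ^ n := by
    have h1 : (V : ℝ) ^ 2 ≤ (((n : ℝ) + 1) ^ 3 * (2 * e * B) ^ (2 * n)) ^ 2 :=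
      pow_le_pow_left₀ hV0 hVa 2
    have h2 : (((n : ℝ) + 1) ^ 3 * (2 * e * B) ^ (2 * n)) ^ 2 =
        ((n : ℝ) + 1) ^ 6 * (16 * e ^ 4 * (B : ℝ) ^ 4) ^ n := by
      rw [mul_pow, ← pow_mul, ← pow_mul, show 16 * e ^ 4 * (B : ℝ) ^ 4 = (2 * e * B) ^ 4 by ring,
        ← pow_mul]
      ring_nf
    rw [h2] at h1
    exact h1
  have hB4 : 16 * e ^ 4 * (B : ℝ) ^ 4 ≤ e ^ 4 / 4096 * (n : ℝ) ^ 3 := by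
    have h1 : (B : ℝ) ^ 4 ≤ (n : ℝ) ^ 3 / 65536 := by
      rw [le_div_iff₀ (by norm_num)]
      nlinarith [hB']
    have h2 : 0 ≤ e ^ 4 := by positivity
    nlinarith
  have hVc : (V : ℝ) ^ 2 ≤ ((n : ℝ) + 1) ^ 6 * ((e ^ 4 / 4096) ^ n * ((n : ℝ) ^ 3) ^ n) := by
    rw [← mul_pow]
    exact hVb.trans (mul_le_mul_of_nonneg_left (pow_le_pow_left₀ (by positivity) hB4 n) (by positivity))
  -- (c)  n^{3n} ≤ n!^3 (e^3)^n
  have hF3 : ((n : ℝ) ^ 3) ^ n ≤ (n.factorial : ℝ) ^ 3 * (e ^ 3) ^ n := by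
    have h1 : (n : ℝ) ^ n ≤ (n.factorial : ℝ) * e ^ n := by
      rw [div_pow, div_le_iff₀ (by positivity)] at hS1
      exact hS1
    calc ((n : ℝ) ^ 3) ^ n = ((n : ℝ) ^ n) ^ 3 := by rw [← pow_mul, ← pow_mul, mul_comm]
      _ ≤ ((n.factorial : ℝ) * e ^ n) ^ 3 := pow_le_pow_left₀ (by positivity) h1 3
      _ = (n.factorial : ℝ) ^ 3 * (e ^ 3) ^ n := by rw [mul_pow, ← pow_mul, ← pow_mul, mul_comm n 3]
  -- (d)  the decay estimate
  have hdecay := pow_six_mul_exp_le_two_pow hc hn1 hcn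
  have h7 : e ^ 7 / 4096 ≤ 1 / 2 := by
    have := exp_one_pow_seven_le
    rw [div_le_iff₀ (by norm_num)]
    linarith
  have hkey : ((n : ℝ) + 1) ^ 6 * (e ^ 7 / 4096) ^ n * Real.exp (2 * c * Real.sqrt n) ≤ 1 := by
    have h1 : (e ^ 7 / 4096) ^ n ≤ (1 / 2) ^ n := pow_le_pow_left₀ (by positivity) h7 n
    have h2 : ((n : ℝ) + 1) ^ 6 * Real.exp (2 * c * Real.sqrt n) * (e ^ 7 / 4096) ^ n ≤
        (2 : ℝ) ^ n * (1 / 2) ^ n :=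
      mul_le_mul hdecay h1 (by positivity) (by positivity)
    rw [← mul_pow] at h2
    norm_num at h2
    linarith
  have hstep : ((n : ℝ) + 1) ^ 6 * (e ^ 7 / 4096) ^ n ≤ Real.exp (-(2 * c * Real.sqrt n)) := by
    rw [Real.exp_neg, ← one_div, le_div_iff₀ (Real.exp_pos _)]
    exact hkey
  -- (e)  threshold² = n!^3 e^{-2c√n}
  set Th : ℝ := (n.factorial : ℝ) ^ ((3 : ℝ) / 2) * Real.exp (-(c * Real.sqrt n)) with hTh
  have hF0 : (0 : ℝ) ≤ (n.factorial : ℝ) := by positivity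
  have hTh0 : 0 ≤ Th := by positivity
  have hTh2 : Th ^ 2 = (n.factorial : ℝ) ^ 3 * Real.exp (-(2 * c * Real.sqrt n)) := by
    have h32 : ((n.factorial : ℝ) ^ ((3 : ℝ) / 2)) ^ 2 = (n.factorial : ℝ) ^ 3 := by
      rw [← Real.rpow_natCast _ 2, ← Real.rpow_mul hF0,
        show ((3 : ℝ) / 2 * ((2 : ℕ) : ℝ)) = ((3 : ℕ) : ℝ) by norm_num, Real.rpow_natCast]
    have hex : (Real.exp (-(c * Real.sqrt n))) ^ 2 = Real.exp (-(2 * c * Real.sqrt n)) := by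
      rw [← Real.exp_nat_mul]; congr 1; push_cast; ring
    rw [hTh, mul_pow, h32, hex]
  have he7 : (e ^ 4 / 4096) ^ n * (e ^ 3) ^ n = (e ^ 7 / 4096) ^ n := by
    rw [← mul_pow]; congr 1; ring
  have hsq : (V : ℝ) ^ 2 ≤ Th ^ 2 := by
    calc (V : ℝ) ^ 2 ≤ ((n : ℝ) + 1) ^ 6 * ((e ^ 4 / 4096) ^ n * ((n : ℝ) ^ 3) ^ n) := hVc
      _ ≤ ((n : ℝ) + 1) ^ 6 * ((e ^ 4 / 4096) ^ n * ((n.factorial : ℝ) ^ 3 * (e ^ 3) ^ n)) := by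
          gcongr
      _ = (n.factorial : ℝ) ^ 3 * (((n : ℝ) + 1) ^ 6 * ((e ^ 4 / 4096) ^ n * (e ^ 3) ^ n)) := by ring
      _ = (n.factorial : ℝ) ^ 3 * (((n : ℝ) + 1) ^ 6 * (e ^ 7 / 4096) ^ n) := by rw [he7]
      _ ≤ (n.factorial : ℝ) ^ 3 * Real.exp (-(2 * c * Real.sqrt n)) :=
          mul_le_mul_of_nonneg_left hstep (by positivity)
      _ = Th ^ 2 := hTh2.symm
  exact (pow_le_pow_iff_left₀ hV0 hTh0 two_ne_zero).1 hsq

end Asymptotics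

end Summit.MatrixMultiplication.MatrixMultiplication.Theorems.ThresholdSubsetTriples.Negative
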